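import Literature.NumberTheory.Automorphic.SelfDualStableLatticeDepthCountRamifiedFrames   -- ★ R2-D (A-p01): generic frame transport + the ramified package ∕ diagonal unit frame at `w`
import HarnessLib

/-!
# DEPTH COUNTS AT A TAMELY RAMIFIED CM PLACE, II (road «R1-ram», brick R-2 FILE R2-E): for `γ ∈ U(σ_w, (Φ₂)_w)(L_w)` regular elliptic, the `γ`-fixed self-dual (edge midpoints)
# and `ϖ_w`-modular (vertices) lattices of `(L_w², (Φ₂)_w)`: FINITE, level-`i` count `Σ_{j ≡ type, j + i ≤ N} m(j)`, exact depth `[i ≤ N ∧ N − i ≡ type]·m(N − i)`, `m(j) = 2q_v^{⌊j∕2⌋}`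
(Labesse–Langlands 1979, §2 p. 8 «`δ_m = 2q^m`»; Jacobowitz 1962, §7–§8; Kottwitz 1988, §2)

Topic `NumberTheory/Automorphic`; namespace `Literature.NumberTheory.Automorphic.UnitaryGroup`.  THEOREMS ONLY (no definition, no instance, no notation, no named fact, no `sorry`).
Cell `pub/hodgecm-mathlib` (D-0151), crux H413 = `stmt-HodgeConjecture-24833`, road «R1-ram» (MEMO-R1ram §4; architect A-p16 (g27) RULINGS A-15 (b) ∕ A-17 (a): «the R-5b assembler
consumes R2-D∕E»), hand A-p01 (g21); the RAMIFIED twin of ★ A-p13 `SelfDualStableLatticeDepthCountCM` ∕ `…CMExact`, with NO parity bit `e`.  HONEST LABEL: HC_CM is proved only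
modulo the printed citations (hLiu418, h413) until rung 0 closes; nothing printed is a letter here.

SETTING.  `L` CM, `v` finite place of `L⁺` NON-SPLIT (`c • w = w`), RAMIFIED in `L` (`he : e(w|v) ≠ 1`), tame (`h2 : |2|_w = 1`); `σ_w := galAdicCompletionMap c hw`;
`ϖ ∈ L_wˣ` an ANTI-FIXED UNIFORMISER (`hϖ : v_w ϖ = exp(−1)`, `hσϖ : σ_w ϖ = −ϖ` — supplied by ★ p04 `exists_uniformizer_galAdicCompletionMap_complexConj_eq_neg_of_ramified`; a binder here,
as in B-p14's EP files); `q_v := |𝓞_{L⁺} ∕ v|`; `(Φ₂)_w = placeForm Φ₂ w.1` (`det = −1`); `γ ∈ U(σ_w, (Φ₂)_w)` with an eigenframe `γ P = P · diag(u)`, `u₀ ≠ u₁` of norm one,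
`|u₀ − u₁|_w = |ϖ^N|` (`N` is odd for the letter's torus `E¹ × E¹` — not used); level token `(γ − u₁·1)Λ ≤ ϖ^iΛ`.
* §1 `exists_diagonal_unit_frame_antidiagTwo_of_ramified` — the R2-C hypotheses DISCHARGED at `(Φ₂)_w`: a frame `Q = P·D` with `ᵗσ_w(Q)(Φ₂)_w Q = diag h`, `|hᵢ| = 1`, `σ_w h = h`,
  `Q⁻¹γQ = !![u₀, 0; 0, u₁]`, and `r := −h₁∕h₀ ∈ 𝒪_w` with `h₀ r = −h₁` and `r̄` a SQUARE (`−h₀h₁ = N(det Q)` since `det Φ₂ = −1`).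
* §2 SELF-DUAL (edge midpoints, `j % 2 = 0`): **`finite_selfDualStable_antidiagTwo_at_ramified`**, **`ncard_selfDualStable_antidiagTwo_level_eq_sum_at_ramified`**,
  **`ncard_selfDualStable_antidiagTwo_depth_eq_ite_at_ramified`** (`#A_i(N) = 2q_v^{(N−i)∕2}`, `1` at `i = N`).
* §3 `ϖ`-MODULAR (vertices, `j % 2 = 1`; token `ϖ • ↑J′ = ᵗσ(g)(Φ₂)_w g`): **`finite_modularStable_antidiagTwo_at_ramified`**, **`ncard_modularStable_antidiagTwo_level_eq_sum_at_ramified`**,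
  **`ncard_modularStable_antidiagTwo_depth_eq_ite_at_ramified`** (`#B_i(N) = 2q_v^{(N−1−i)∕2}`) — B-p12 (g29) cert `TABLE-J-ramified.md` READING (3).

## References
* [LabesseLanglands1979] J.-P. Labesse, R. P. Langlands, *L-indistinguishability for SL(2)*, Canad. J. Math. 31 (1979), §2 p. 8.
* [Jacobowitz1962] R. Jacobowitz, *Hermitian forms over local fields*, Amer. J. Math. 84 (1962), §7–§8.
* [Kottwitz1988] R. E. Kottwitz, *Tamagawa numbers*, Ann. of Math. 127 (1988), §2.
* [Rogawski1990] J. D. Rogawski, *Automorphic Representations of Unitary Groups in Three Variables* (1990), §4.9 Lemma 4.9.3 p. 56.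
-/

set_option autoImplicit false

noncomputable section

open NumberField IsDedekindDomain Matrix Finset ValuativeRel IsLocalRing
open scoped ValuativeRel Matrix MatrixGroups

namespace Literature.NumberTheory.Automorphic.UnitaryGroup

open Literature.NumberTheory.Rogawski1990 Literature.NumberTheory.GaloisRepresentations Literature.NumberTheory.LocalFields

variable (L : Type) [Field L] [NumberField L] [IsCMField L] (v : HeightOneSpectrum (𝓞 ↥(maximalRealSubfield L)))
  (w : PlacesOver L v) (hw : IsCMField.complexConj L • w.1 = w.1)

/-! ## §1 The R2-C hypotheses discharged at `(Φ₂)_w` -/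

section Frame

include hw in
/-- **THE DIAGONAL UNIT FRAME AT `(Φ₂)_w` (ramified)**: for `γ ∈ U(σ_w, (Φ₂)_w)` with an eigenframe `γ P = P · diag(u)` (`u₀ ≠ u₁` of norm one) there are a frame `Q` and units
`h₀, h₁` (`v_w(hᵢ) = 1`, `σ_w hᵢ = hᵢ`) with `ᵗσ_w(Q)(Φ₂)_w Q = diag h`, `Q⁻¹γQ = !![u₀, 0; 0, u₁]`, and an `r ∈ 𝒪_w` with `h₀ r = −h₁` whose residue is a SQUARE
(`r = N(det Q ∕ h₀)`, as `det (Φ₂)_w = −1`). [cite: Rogawski1990, §4.9 Lemma 4.9.3 p. 56] [cite: Jacobowitz1962, §8] -/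
theorem exists_diagonal_unit_frame_antidiagTwo_of_ramified (he : v.asIdeal.ramificationIdx' w.1.asIdeal ≠ 1) (h2 : Valued.v (2 : w.1.adicCompletion L) = 1)
    (σO : 𝒪[w.1.adicCompletion L] →+* 𝒪[w.1.adicCompletion L])
    (hσO' : ∀ x : 𝒪[w.1.adicCompletion L], ((σO x : 𝒪[w.1.adicCompletion L]) : w.1.adicCompletion L) = galAdicCompletionMap (L := L) (IsCMField.complexConj L) hw x)
    (hres : ∀ x, σO x - x ∈ maximalIdeal 𝒪[w.1.adicCompletion L])
    {γ P : GL (Fin 2) (w.1.adicCompletion L)} {u : Fin 2 → w.1.adicCompletion L}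
    (hγ : γ ∈ Literature.AlgebraicGeometry.ShimuraVarieties.unitaryGroup (galAdicCompletionMap (L := L) (IsCMField.complexConj L) hw)
      (placeForm (Matrix.of fun i j : Fin 2 => if i.val + j.val + 1 = 2 then (1 : L) else 0) w.1))
    (hP : (γ : Matrix (Fin 2) (Fin 2) (w.1.adicCompletion L)) * P = P * diagonal u) (hu : Function.Injective u)
    (hu1 : ∀ i, galAdicCompletionMap (L := L) (IsCMField.complexConj L) hw (u i) * u i = 1) :
    ∃ (Q : GL (Fin 2) (w.1.adicCompletion L)) (h : Fin 2 → w.1.adicCompletion L) (r : 𝒪[w.1.adicCompletion L]),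
      (∀ i, valuation (w.1.adicCompletion L) (h i) = 1) ∧ (∀ i, galAdicCompletionMap (L := L) (IsCMField.complexConj L) hw (h i) = h i) ∧
      formCongr (galAdicCompletionMap (L := L) (IsCMField.complexConj L) hw) Q
        (placeForm (Matrix.of fun i j : Fin 2 => if i.val + j.val + 1 = 2 then (1 : L) else 0) w.1) = diagonal h ∧
      ((Q⁻¹ * γ * Q : GL (Fin 2) (w.1.adicCompletion L)) : Matrix (Fin 2) (Fin 2) (w.1.adicCompletion L)) = !![u 0, 0; 0, u 1] ∧
      h 0 * (r : w.1.adicCompletion L) = -h 1 ∧ IsSquare (residue 𝒪[w.1.adicCompletion L] r) := by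
  set K := w.1.adicCompletion L
  set σ := galAdicCompletionMap (L := L) (IsCMField.complexConj L) hw with hσ
  have hσσ : ∀ x, σ (σ x) = x :=
    galAdicCompletionMap_galAdicCompletionMap_of_smul_eq (IsCMField.complexConj L) w (IsCMField.complexConj_ne_one L) hw
  obtain ⟨c, D, h, hD, hv, hfix, hform, hdet⟩ := exists_rescaling_formCongr_eq_diagonal_of_ramified L v w hw he h2 (placeForm_antidiagTwo_hermitian L v w hw)
    (det_placeForm_antidiagTwo_ne_zero_and_even L v w).1 hγ hP hu hu1
  rw [det_placeForm_antidiagTwo] at hdet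
  have hval : ∀ i, valuation K (h i) = 1 := fun i => (v_eq_one_iff_valuation_eq_one (h i)).1 (hv i)
  have hh0 : h 0 ≠ 0 := fun e => by have := hval 0; rw [e, map_zero] at this; exact zero_ne_one this
  -- `r = −h₁/h₀ = N(s)`, `s := det Q / h₀`
  obtain ⟨s, hs⟩ : ∃ s : K, s = (P * D).val.det * (h 0)⁻¹ := ⟨_, rfl⟩
  have hrs : σ s * s = -h 1 * (h 0)⁻¹ := by
    rw [hs, map_mul, map_inv₀, hfix]
    field_simp
    linear_combination hdet
  -- `|s| = 1`: `|σ s · s| = |s|²` and `|−h₁∕h₀| = 1`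
  have hr1 : valuation K (-h 1 * (h 0)⁻¹) = 1 := by rw [map_mul, Valuation.map_neg, map_inv₀, hval, hval, inv_one, one_mul]
  have hs1 : valuation K s = 1 := by
    have hsq : valuation K s * valuation K s = 1 := by
      have h' : valuation K (σ s * s) = 1 := by rw [hrs]; exact hr1
      rwa [map_mul, valuation_galAdicCompletionMap_eq (IsCMField.complexConj L) v w hw s] at h'
    rcases lt_trichotomy (valuation K s) 1 with hlt | heq | hgt
    · exact absurd hsq (mul_lt_one' hlt hlt).ne
    · exact heq
    · exact absurd hsq (one_lt_mul'' hgt hgt).ne'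
  let rO : 𝒪[K] := ⟨-h 1 * (h 0)⁻¹, (Valuation.mem_integer_iff _ _).2 hr1.le⟩
  let sO : 𝒪[K] := ⟨s, (Valuation.mem_integer_iff _ _).2 hs1.le⟩
  have hsq : IsSquare (residue 𝒪[K] rO) := by
    refine RamifiedQuadraticNorm.isSquare_residue_of_mul_map_eq σO hres (s := sO) (Subtype.ext ?_)
    show s * ((σO sO : 𝒪[K]) : K) = -h 1 * (h 0)⁻¹
    rw [hσO', mul_comm]; exact hrs
  refine ⟨P * D, h, rO, hval, hfix, hform, coe_inv_mul_mul_eq_of_eigenframe L v w hP hD, ?_, hsq⟩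
  show h 0 * (-h 1 * (h 0)⁻¹) = -h 1
  field_simp

end Frame

/-! ## §2 The self-dual (edge midpoint) vertices -/

section SelfDual

include hw in
/-- **THE `γ`-FIXED SELF-DUAL VERTICES (edge midpoints) AT A TAMELY RAMIFIED `w` FORM A FINITE SET** (★ R2-D frame + ★ R2-C; level `0` is automatic).
[cite: Kottwitz1988, §2] [cite: LabesseLanglands1979, §2 p. 8] -/
theorem finite_selfDualStable_antidiagTwo_at_ramified (he : v.asIdeal.ramificationIdx' w.1.asIdeal ≠ 1) (h2 : Valued.v (2 : w.1.adicCompletion L) = 1)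
    (ϖ : (w.1.adicCompletion L)ˣ) (hϖ : Valued.v (ϖ : w.1.adicCompletion L) = WithZero.exp (-1 : ℤ))
    (hσϖ : galAdicCompletionMap (L := L) (IsCMField.complexConj L) hw ϖ = -ϖ)
    {γ P : GL (Fin 2) (w.1.adicCompletion L)} {u : Fin 2 → w.1.adicCompletion L}
    (hγ : γ ∈ Literature.AlgebraicGeometry.ShimuraVarieties.unitaryGroup (galAdicCompletionMap (L := L) (IsCMField.complexConj L) hw)
      (placeForm (Matrix.of fun i j : Fin 2 => if i.val + j.val + 1 = 2 then (1 : L) else 0) w.1))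
    (hP : (γ : Matrix (Fin 2) (Fin 2) (w.1.adicCompletion L)) * P = P * diagonal u) (hu : Function.Injective u)
    (hu1 : ∀ i, galAdicCompletionMap (L := L) (IsCMField.complexConj L) hw (u i) * u i = 1) {N : ℕ}
    (hN : valuation (w.1.adicCompletion L) (u 0 - u 1) = valuation (w.1.adicCompletion L) ((ϖ : w.1.adicCompletion L) ^ N)) :
    {Λ : Submodule 𝒪[w.1.adicCompletion L] (Fin 2 → w.1.adicCompletion L) |
        (∃ g : GL (Fin 2) (w.1.adicCompletion L),
          (∃ J' ∈ glInt 2 (w.1.adicCompletion L), (J' : Matrix (Fin 2) (Fin 2) (w.1.adicCompletion L)) =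
            formCongr (galAdicCompletionMap (L := L) (IsCMField.complexConj L) hw) g
              (placeForm (Matrix.of fun i j : Fin 2 => if i.val + j.val + 1 = 2 then (1 : L) else 0) w.1)) ∧
          Λ = Submodule.span 𝒪[w.1.adicCompletion L] (Set.range ((g : Matrix (Fin 2) (Fin 2) (w.1.adicCompletion L)))ᵀ)) ∧
        Λ.map ((Matrix.toLin' ((γ : GL (Fin 2) (w.1.adicCompletion L)) : Matrix (Fin 2) (Fin 2) (w.1.adicCompletion L))).restrictScalars
          𝒪[w.1.adicCompletion L]) = Λ}.Finite := by
  obtain ⟨σO, hσO', hσσ, hres, hq⟩ := exists_integer_involution_complexConj_of_ramified L v w hw he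
  obtain ⟨Q, h, r, hval, hfix, hform, hQγ, hr, hsq⟩ := exists_diagonal_unit_frame_antidiagTwo_of_ramified L v w hw he h2 σO hσO' hres hγ hP hu hu1
  have hϖ' : IsUniformizingElement (ϖ : w.1.adicCompletion L) := isUniformizingElement_of_v_eq hϖ
  haveI : IsDiscreteValuationRing 𝒪[w.1.adicCompletion L] := isDiscreteValuationRing_integer_of_compatible hϖ
  have h2O : IsUnit (2 : 𝒪[w.1.adicCompletion L]) := by
    rw [(Valuation.integer.integers (valuation (w.1.adicCompletion L))).isUnit_iff_valuation_eq_one, map_ofNat]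
    exact (v_eq_one_iff_valuation_eq_one (2 : w.1.adicCompletion L)).1 h2
  have huv : ∀ i, valuation (w.1.adicCompletion L) (u i) = 1 := fun i => valuation_eq_one_of_galAdicCompletionMap_mul_self L v w hw (hu1 i)
  have hform0 : formCongr (galAdicCompletionMap (L := L) (IsCMField.complexConj L) hw) Q
      (placeForm (Matrix.of fun i j : Fin 2 => if i.val + j.val + 1 = 2 then (1 : L) else 0) w.1) =
        (ϖ : w.1.adicCompletion L) ^ (-((0 : ℕ) : ℤ)) • diagonal h := by
    rw [hform, Nat.cast_zero, neg_zero, zpow_zero, one_smul]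
  exact (finite_and_ncard_selfDualStable_of_diagonal_frame (galAdicCompletionMap (L := L) (IsCMField.complexConj L) hw) hϖ' σO hσO' hσσ hres h2O hσϖ
    (hval 0) (hval 1) hfix r hr hsq (Nat.zero_le 1) (placeForm (Matrix.of fun i j : Fin 2 => if i.val + j.val + 1 = 2 then (1 : L) else 0) w.1) γ Q hQγ
    (huv 0) (huv 1) hN hform0 hq 0).1

include hw in
/-- **CUMULATIVE LEVEL-`i` COUNT OF THE `γ`-FIXED SELF-DUAL VERTICES AT A TAMELY RAMIFIED `w`**: for `γ ∈ U(σ_w, (Φ₂)_w)` with eigenframe `γ P = P · diag(u)` (`u₀ ≠ u₁` of norm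
one, `|u₀ − u₁|_w = |ϖ^N|`, `ϖ` an anti-fixed uniformiser), `#{Λ ∈ S((Φ₂)_w, γ) | (γ − u₁·1)Λ ≤ ϖ^iΛ} = Σ_{j ≤ N, j even, j + i ≤ N} m(j)`, `m(0) = 1`, `m(j) = 2q_v^{j∕2}` — the edge
midpoints of the `X′`-ball `B(Λ_C, N − i)`; NO parity bit (contrast ★ inert `exists_ncard_selfDualStable_antidiagTwo_level_eq_sum_at`). [cite: LabesseLanglands1979, §2 p. 8]
[cite: Kottwitz1988, §2] [cite: Rogawski1990, §4.9 Lemma 4.9.3 p. 56] -/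
theorem ncard_selfDualStable_antidiagTwo_level_eq_sum_at_ramified (he : v.asIdeal.ramificationIdx' w.1.asIdeal ≠ 1) (h2 : Valued.v (2 : w.1.adicCompletion L) = 1)
    (ϖ : (w.1.adicCompletion L)ˣ) (hϖ : Valued.v (ϖ : w.1.adicCompletion L) = WithZero.exp (-1 : ℤ))
    (hσϖ : galAdicCompletionMap (L := L) (IsCMField.complexConj L) hw ϖ = -ϖ)
    {γ P : GL (Fin 2) (w.1.adicCompletion L)} {u : Fin 2 → w.1.adicCompletion L}
    (hγ : γ ∈ Literature.AlgebraicGeometry.ShimuraVarieties.unitaryGroup (galAdicCompletionMap (L := L) (IsCMField.complexConj L) hw)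
      (placeForm (Matrix.of fun i j : Fin 2 => if i.val + j.val + 1 = 2 then (1 : L) else 0) w.1))
    (hP : (γ : Matrix (Fin 2) (Fin 2) (w.1.adicCompletion L)) * P = P * diagonal u) (hu : Function.Injective u)
    (hu1 : ∀ i, galAdicCompletionMap (L := L) (IsCMField.complexConj L) hw (u i) * u i = 1) {N : ℕ}
    (hN : valuation (w.1.adicCompletion L) (u 0 - u 1) = valuation (w.1.adicCompletion L) ((ϖ : w.1.adicCompletion L) ^ N)) (i : ℕ) :
    {Λ : Submodule 𝒪[w.1.adicCompletion L] (Fin 2 → w.1.adicCompletion L) |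
        ((∃ g : GL (Fin 2) (w.1.adicCompletion L),
          (∃ J' ∈ glInt 2 (w.1.adicCompletion L), (J' : Matrix (Fin 2) (Fin 2) (w.1.adicCompletion L)) =
            formCongr (galAdicCompletionMap (L := L) (IsCMField.complexConj L) hw) g
              (placeForm (Matrix.of fun i j : Fin 2 => if i.val + j.val + 1 = 2 then (1 : L) else 0) w.1)) ∧
          Λ = Submodule.span 𝒪[w.1.adicCompletion L] (Set.range ((g : Matrix (Fin 2) (Fin 2) (w.1.adicCompletion L)))ᵀ)) ∧
        Λ.map ((Matrix.toLin' ((γ : GL (Fin 2) (w.1.adicCompletion L)) : Matrix (Fin 2) (Fin 2) (w.1.adicCompletion L))).restrictScalars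
          𝒪[w.1.adicCompletion L]) = Λ) ∧
        Λ.map ((Matrix.toLin' (((γ : GL (Fin 2) (w.1.adicCompletion L)) : Matrix (Fin 2) (Fin 2) (w.1.adicCompletion L)) -
            u 1 • (1 : Matrix (Fin 2) (Fin 2) (w.1.adicCompletion L)))).restrictScalars 𝒪[w.1.adicCompletion L]) ≤
          Λ.map ((Matrix.toLin' ((ϖ : w.1.adicCompletion L) ^ i • (1 : Matrix (Fin 2) (Fin 2) (w.1.adicCompletion L)))).restrictScalars 𝒪[w.1.adicCompletion L])}.ncard =
      ∑ j ∈ (range (N + 1)).filter (fun j => j % 2 = 0 ∧ j + i ≤ N), (if j = 0 then 1 else 2 * Nat.card (𝓞 ↥(maximalRealSubfield L) ⧸ v.asIdeal) ^ (j / 2)) := by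
  obtain ⟨σO, hσO', hσσ, hres, hq⟩ := exists_integer_involution_complexConj_of_ramified L v w hw he
  obtain ⟨Q, h, r, hval, hfix, hform, hQγ, hr, hsq⟩ := exists_diagonal_unit_frame_antidiagTwo_of_ramified L v w hw he h2 σO hσO' hres hγ hP hu hu1
  have hϖ' : IsUniformizingElement (ϖ : w.1.adicCompletion L) := isUniformizingElement_of_v_eq hϖ
  haveI : IsDiscreteValuationRing 𝒪[w.1.adicCompletion L] := isDiscreteValuationRing_integer_of_compatible hϖ
  have h2O : IsUnit (2 : 𝒪[w.1.adicCompletion L]) := by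
    rw [(Valuation.integer.integers (valuation (w.1.adicCompletion L))).isUnit_iff_valuation_eq_one, map_ofNat]
    exact (v_eq_one_iff_valuation_eq_one (2 : w.1.adicCompletion L)).1 h2
  have huv : ∀ i, valuation (w.1.adicCompletion L) (u i) = 1 := fun i => valuation_eq_one_of_galAdicCompletionMap_mul_self L v w hw (hu1 i)
  have hform0 : formCongr (galAdicCompletionMap (L := L) (IsCMField.complexConj L) hw) Q
      (placeForm (Matrix.of fun i j : Fin 2 => if i.val + j.val + 1 = 2 then (1 : L) else 0) w.1) =
        (ϖ : w.1.adicCompletion L) ^ (-((0 : ℕ) : ℤ)) • diagonal h := by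
    rw [hform, Nat.cast_zero, neg_zero, zpow_zero, one_smul]
  exact (finite_and_ncard_selfDualStable_of_diagonal_frame (galAdicCompletionMap (L := L) (IsCMField.complexConj L) hw) hϖ' σO hσO' hσσ hres h2O hσϖ
    (hval 0) (hval 1) hfix r hr hsq (Nat.zero_le 1) (placeForm (Matrix.of fun i j : Fin 2 => if i.val + j.val + 1 = 2 then (1 : L) else 0) w.1) γ Q hQγ
    (huv 0) (huv 1) hN hform0 hq i).2.1

set_option maxHeartbeats 400000 in
include hw in
/-- **EXACT-DEPTH COUNT OF THE `γ`-FIXED SELF-DUAL VERTICES AT A TAMELY RAMIFIED `w`**: `#{Λ ∈ S((Φ₂)_w, γ) | (γ − u₁·1)Λ ≤ ϖ^iΛ ∧ ¬ (γ − u₁·1)Λ ≤ ϖ^{i+1}Λ} =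
[i ≤ N ∧ N − i even]·m(N − i)` — B-p12 (g29) cert `TABLE-J-ramified.md` READING (3): `#A_i(N) = 2q_v^{(N−i)∕2}` (`i < N`), `1` (`i = N`). [cite: LabesseLanglands1979, §2 p. 8] [cite: Kottwitz1988, §2] -/
theorem ncard_selfDualStable_antidiagTwo_depth_eq_ite_at_ramified (he : v.asIdeal.ramificationIdx' w.1.asIdeal ≠ 1) (h2 : Valued.v (2 : w.1.adicCompletion L) = 1)
    (ϖ : (w.1.adicCompletion L)ˣ) (hϖ : Valued.v (ϖ : w.1.adicCompletion L) = WithZero.exp (-1 : ℤ))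
    (hσϖ : galAdicCompletionMap (L := L) (IsCMField.complexConj L) hw ϖ = -ϖ)
    {γ P : GL (Fin 2) (w.1.adicCompletion L)} {u : Fin 2 → w.1.adicCompletion L}
    (hγ : γ ∈ Literature.AlgebraicGeometry.ShimuraVarieties.unitaryGroup (galAdicCompletionMap (L := L) (IsCMField.complexConj L) hw)
      (placeForm (Matrix.of fun i j : Fin 2 => if i.val + j.val + 1 = 2 then (1 : L) else 0) w.1))
    (hP : (γ : Matrix (Fin 2) (Fin 2) (w.1.adicCompletion L)) * P = P * diagonal u) (hu : Function.Injective u)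
    (hu1 : ∀ i, galAdicCompletionMap (L := L) (IsCMField.complexConj L) hw (u i) * u i = 1) {N : ℕ}
    (hN : valuation (w.1.adicCompletion L) (u 0 - u 1) = valuation (w.1.adicCompletion L) ((ϖ : w.1.adicCompletion L) ^ N)) (i : ℕ) :
    {Λ : Submodule 𝒪[w.1.adicCompletion L] (Fin 2 → w.1.adicCompletion L) |
        ((∃ g : GL (Fin 2) (w.1.adicCompletion L),
          (∃ J' ∈ glInt 2 (w.1.adicCompletion L), (J' : Matrix (Fin 2) (Fin 2) (w.1.adicCompletion L)) =
            formCongr (galAdicCompletionMap (L := L) (IsCMField.complexConj L) hw) g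
              (placeForm (Matrix.of fun i j : Fin 2 => if i.val + j.val + 1 = 2 then (1 : L) else 0) w.1)) ∧
          Λ = Submodule.span 𝒪[w.1.adicCompletion L] (Set.range ((g : Matrix (Fin 2) (Fin 2) (w.1.adicCompletion L)))ᵀ)) ∧
        Λ.map ((Matrix.toLin' ((γ : GL (Fin 2) (w.1.adicCompletion L)) : Matrix (Fin 2) (Fin 2) (w.1.adicCompletion L))).restrictScalars
          𝒪[w.1.adicCompletion L]) = Λ) ∧
        (Λ.map ((Matrix.toLin' (((γ : GL (Fin 2) (w.1.adicCompletion L)) : Matrix (Fin 2) (Fin 2) (w.1.adicCompletion L)) -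
            u 1 • (1 : Matrix (Fin 2) (Fin 2) (w.1.adicCompletion L)))).restrictScalars 𝒪[w.1.adicCompletion L]) ≤
          Λ.map ((Matrix.toLin' ((ϖ : w.1.adicCompletion L) ^ i • (1 : Matrix (Fin 2) (Fin 2) (w.1.adicCompletion L)))).restrictScalars 𝒪[w.1.adicCompletion L]) ∧
        ¬ Λ.map ((Matrix.toLin' (((γ : GL (Fin 2) (w.1.adicCompletion L)) : Matrix (Fin 2) (Fin 2) (w.1.adicCompletion L)) -
            u 1 • (1 : Matrix (Fin 2) (Fin 2) (w.1.adicCompletion L)))).restrictScalars 𝒪[w.1.adicCompletion L]) ≤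
          Λ.map ((Matrix.toLin' ((ϖ : w.1.adicCompletion L) ^ (i + 1) • (1 : Matrix (Fin 2) (Fin 2) (w.1.adicCompletion L)))).restrictScalars 𝒪[w.1.adicCompletion L]))}.ncard =
      (if i ≤ N ∧ (N - i) % 2 = 0 then (if N - i = 0 then 1 else 2 * Nat.card (𝓞 ↥(maximalRealSubfield L) ⧸ v.asIdeal) ^ ((N - i) / 2)) else 0) := by
  obtain ⟨σO, hσO', hσσ, hres, hq⟩ := exists_integer_involution_complexConj_of_ramified L v w hw he
  obtain ⟨Q, h, r, hval, hfix, hform, hQγ, hr, hsq⟩ := exists_diagonal_unit_frame_antidiagTwo_of_ramified L v w hw he h2 σO hσO' hres hγ hP hu hu1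
  have hϖ' : IsUniformizingElement (ϖ : w.1.adicCompletion L) := isUniformizingElement_of_v_eq hϖ
  haveI : IsDiscreteValuationRing 𝒪[w.1.adicCompletion L] := isDiscreteValuationRing_integer_of_compatible hϖ
  have h2O : IsUnit (2 : 𝒪[w.1.adicCompletion L]) := by
    rw [(Valuation.integer.integers (valuation (w.1.adicCompletion L))).isUnit_iff_valuation_eq_one, map_ofNat]
    exact (v_eq_one_iff_valuation_eq_one (2 : w.1.adicCompletion L)).1 h2
  have huv : ∀ i, valuation (w.1.adicCompletion L) (u i) = 1 := fun i => valuation_eq_one_of_galAdicCompletionMap_mul_self L v w hw (hu1 i)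
  have hform0 : formCongr (galAdicCompletionMap (L := L) (IsCMField.complexConj L) hw) Q
      (placeForm (Matrix.of fun i j : Fin 2 => if i.val + j.val + 1 = 2 then (1 : L) else 0) w.1) =
        (ϖ : w.1.adicCompletion L) ^ (-((0 : ℕ) : ℤ)) • diagonal h := by
    rw [hform, Nat.cast_zero, neg_zero, zpow_zero, one_smul]
  exact (finite_and_ncard_selfDualStable_of_diagonal_frame (galAdicCompletionMap (L := L) (IsCMField.complexConj L) hw) hϖ' σO hσO' hσσ hres h2O hσϖ
    (hval 0) (hval 1) hfix r hr hsq (Nat.zero_le 1) (placeForm (Matrix.of fun i j : Fin 2 => if i.val + j.val + 1 = 2 then (1 : L) else 0) w.1) γ Q hQγ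
    (huv 0) (huv 1) hN hform0 hq i).2.2

end SelfDual

/-! ## §3 The `ϖ`-modular vertices -/

section Modular

include hw in
/-- **THE `γ`-FIXED `ϖ`-MODULAR VERTICES AT A TAMELY RAMIFIED `w` FORM A FINITE SET** (token `ϖ • ↑J′ = ᵗσ_w(g)(Φ₂)_w g`; ★ R2-D frame + ★ R2-C at `d = 1`).
[cite: Kottwitz1988, §2] [cite: Jacobowitz1962, §8] -/
theorem finite_modularStable_antidiagTwo_at_ramified (he : v.asIdeal.ramificationIdx' w.1.asIdeal ≠ 1) (h2 : Valued.v (2 : w.1.adicCompletion L) = 1)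
    (ϖ : (w.1.adicCompletion L)ˣ) (hϖ : Valued.v (ϖ : w.1.adicCompletion L) = WithZero.exp (-1 : ℤ))
    (hσϖ : galAdicCompletionMap (L := L) (IsCMField.complexConj L) hw ϖ = -ϖ)
    {γ P : GL (Fin 2) (w.1.adicCompletion L)} {u : Fin 2 → w.1.adicCompletion L}
    (hγ : γ ∈ Literature.AlgebraicGeometry.ShimuraVarieties.unitaryGroup (galAdicCompletionMap (L := L) (IsCMField.complexConj L) hw)
      (placeForm (Matrix.of fun i j : Fin 2 => if i.val + j.val + 1 = 2 then (1 : L) else 0) w.1))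
    (hP : (γ : Matrix (Fin 2) (Fin 2) (w.1.adicCompletion L)) * P = P * diagonal u) (hu : Function.Injective u)
    (hu1 : ∀ i, galAdicCompletionMap (L := L) (IsCMField.complexConj L) hw (u i) * u i = 1) {N : ℕ}
    (hN : valuation (w.1.adicCompletion L) (u 0 - u 1) = valuation (w.1.adicCompletion L) ((ϖ : w.1.adicCompletion L) ^ N)) :
    {Λ : Submodule 𝒪[w.1.adicCompletion L] (Fin 2 → w.1.adicCompletion L) |
        (∃ g : GL (Fin 2) (w.1.adicCompletion L),
          (∃ J' ∈ glInt 2 (w.1.adicCompletion L), (ϖ : w.1.adicCompletion L) • (J' : Matrix (Fin 2) (Fin 2) (w.1.adicCompletion L)) =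
            formCongr (galAdicCompletionMap (L := L) (IsCMField.complexConj L) hw) g
              (placeForm (Matrix.of fun i j : Fin 2 => if i.val + j.val + 1 = 2 then (1 : L) else 0) w.1)) ∧
          Λ = Submodule.span 𝒪[w.1.adicCompletion L] (Set.range ((g : Matrix (Fin 2) (Fin 2) (w.1.adicCompletion L)))ᵀ)) ∧
        Λ.map ((Matrix.toLin' ((γ : GL (Fin 2) (w.1.adicCompletion L)) : Matrix (Fin 2) (Fin 2) (w.1.adicCompletion L))).restrictScalars
          𝒪[w.1.adicCompletion L]) = Λ}.Finite := by
  obtain ⟨σO, hσO', hσσ, hres, hq⟩ := exists_integer_involution_complexConj_of_ramified L v w hw he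
  obtain ⟨Q, h, r, hval, hfix, hform, hQγ, hr, hsq⟩ := exists_diagonal_unit_frame_antidiagTwo_of_ramified L v w hw he h2 σO hσO' hres hγ hP hu hu1
  have hϖ' : IsUniformizingElement (ϖ : w.1.adicCompletion L) := isUniformizingElement_of_v_eq hϖ
  haveI : IsDiscreteValuationRing 𝒪[w.1.adicCompletion L] := isDiscreteValuationRing_integer_of_compatible hϖ
  have h2O : IsUnit (2 : 𝒪[w.1.adicCompletion L]) := by
    rw [(Valuation.integer.integers (valuation (w.1.adicCompletion L))).isUnit_iff_valuation_eq_one, map_ofNat]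
    exact (v_eq_one_iff_valuation_eq_one (2 : w.1.adicCompletion L)).1 h2
  have huv : ∀ i, valuation (w.1.adicCompletion L) (u i) = 1 := fun i => valuation_eq_one_of_galAdicCompletionMap_mul_self L v w hw (hu1 i)
  have hform1 : formCongr (galAdicCompletionMap (L := L) (IsCMField.complexConj L) hw) Q
      ((ϖ : w.1.adicCompletion L)⁻¹ • placeForm (Matrix.of fun i j : Fin 2 => if i.val + j.val + 1 = 2 then (1 : L) else 0) w.1) =
        (ϖ : w.1.adicCompletion L) ^ (-((1 : ℕ) : ℤ)) • diagonal h := by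
    rw [formCongr_smul_form, hform, Nat.cast_one, _root_.zpow_neg_one]
  exact (finite_and_ncard_modularStable_of_diagonal_frame (galAdicCompletionMap (L := L) (IsCMField.complexConj L) hw) hϖ' σO hσO' hσσ hres h2O hσϖ
    (hval 0) (hval 1) hfix r hr hsq (placeForm (Matrix.of fun i j : Fin 2 => if i.val + j.val + 1 = 2 then (1 : L) else 0) w.1) γ Q hQγ
    (huv 0) (huv 1) hN hq hform1 0).1

include hw in
/-- **CUMULATIVE LEVEL-`i` COUNT OF THE `γ`-FIXED `ϖ`-MODULAR VERTICES AT A TAMELY RAMIFIED `w`** (the `(q_v+1)`-valent VERTICES of the barycentric tree `X′`):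
`#{Λ ∈ M((Φ₂)_w, γ) | (γ − u₁·1)Λ ≤ ϖ^iΛ} = Σ_{j ≤ N, j odd, j + i ≤ N} 2q_v^{⌊j∕2⌋}`. [cite: LabesseLanglands1979, §2 p. 8] [cite: Kottwitz1988, §2] [cite: Jacobowitz1962, §8] -/
theorem ncard_modularStable_antidiagTwo_level_eq_sum_at_ramified (he : v.asIdeal.ramificationIdx' w.1.asIdeal ≠ 1) (h2 : Valued.v (2 : w.1.adicCompletion L) = 1)
    (ϖ : (w.1.adicCompletion L)ˣ) (hϖ : Valued.v (ϖ : w.1.adicCompletion L) = WithZero.exp (-1 : ℤ))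
    (hσϖ : galAdicCompletionMap (L := L) (IsCMField.complexConj L) hw ϖ = -ϖ)
    {γ P : GL (Fin 2) (w.1.adicCompletion L)} {u : Fin 2 → w.1.adicCompletion L}
    (hγ : γ ∈ Literature.AlgebraicGeometry.ShimuraVarieties.unitaryGroup (galAdicCompletionMap (L := L) (IsCMField.complexConj L) hw)
      (placeForm (Matrix.of fun i j : Fin 2 => if i.val + j.val + 1 = 2 then (1 : L) else 0) w.1))
    (hP : (γ : Matrix (Fin 2) (Fin 2) (w.1.adicCompletion L)) * P = P * diagonal u) (hu : Function.Injective u)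
    (hu1 : ∀ i, galAdicCompletionMap (L := L) (IsCMField.complexConj L) hw (u i) * u i = 1) {N : ℕ}
    (hN : valuation (w.1.adicCompletion L) (u 0 - u 1) = valuation (w.1.adicCompletion L) ((ϖ : w.1.adicCompletion L) ^ N)) (i : ℕ) :
    {Λ : Submodule 𝒪[w.1.adicCompletion L] (Fin 2 → w.1.adicCompletion L) |
        ((∃ g : GL (Fin 2) (w.1.adicCompletion L),
          (∃ J' ∈ glInt 2 (w.1.adicCompletion L), (ϖ : w.1.adicCompletion L) • (J' : Matrix (Fin 2) (Fin 2) (w.1.adicCompletion L)) =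
            formCongr (galAdicCompletionMap (L := L) (IsCMField.complexConj L) hw) g
              (placeForm (Matrix.of fun i j : Fin 2 => if i.val + j.val + 1 = 2 then (1 : L) else 0) w.1)) ∧
          Λ = Submodule.span 𝒪[w.1.adicCompletion L] (Set.range ((g : Matrix (Fin 2) (Fin 2) (w.1.adicCompletion L)))ᵀ)) ∧
        Λ.map ((Matrix.toLin' ((γ : GL (Fin 2) (w.1.adicCompletion L)) : Matrix (Fin 2) (Fin 2) (w.1.adicCompletion L))).restrictScalars
          𝒪[w.1.adicCompletion L]) = Λ) ∧
        Λ.map ((Matrix.toLin' (((γ : GL (Fin 2) (w.1.adicCompletion L)) : Matrix (Fin 2) (Fin 2) (w.1.adicCompletion L)) -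
            u 1 • (1 : Matrix (Fin 2) (Fin 2) (w.1.adicCompletion L)))).restrictScalars 𝒪[w.1.adicCompletion L]) ≤
          Λ.map ((Matrix.toLin' ((ϖ : w.1.adicCompletion L) ^ i • (1 : Matrix (Fin 2) (Fin 2) (w.1.adicCompletion L)))).restrictScalars 𝒪[w.1.adicCompletion L])}.ncard =
      ∑ j ∈ (range (N + 1)).filter (fun j => j % 2 = 1 ∧ j + i ≤ N), (if j = 0 then 1 else 2 * Nat.card (𝓞 ↥(maximalRealSubfield L) ⧸ v.asIdeal) ^ (j / 2)) := by
  obtain ⟨σO, hσO', hσσ, hres, hq⟩ := exists_integer_involution_complexConj_of_ramified L v w hw he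
  obtain ⟨Q, h, r, hval, hfix, hform, hQγ, hr, hsq⟩ := exists_diagonal_unit_frame_antidiagTwo_of_ramified L v w hw he h2 σO hσO' hres hγ hP hu hu1
  have hϖ' : IsUniformizingElement (ϖ : w.1.adicCompletion L) := isUniformizingElement_of_v_eq hϖ
  haveI : IsDiscreteValuationRing 𝒪[w.1.adicCompletion L] := isDiscreteValuationRing_integer_of_compatible hϖ
  have h2O : IsUnit (2 : 𝒪[w.1.adicCompletion L]) := by
    rw [(Valuation.integer.integers (valuation (w.1.adicCompletion L))).isUnit_iff_valuation_eq_one, map_ofNat]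
    exact (v_eq_one_iff_valuation_eq_one (2 : w.1.adicCompletion L)).1 h2
  have huv : ∀ i, valuation (w.1.adicCompletion L) (u i) = 1 := fun i => valuation_eq_one_of_galAdicCompletionMap_mul_self L v w hw (hu1 i)
  have hform1 : formCongr (galAdicCompletionMap (L := L) (IsCMField.complexConj L) hw) Q
      ((ϖ : w.1.adicCompletion L)⁻¹ • placeForm (Matrix.of fun i j : Fin 2 => if i.val + j.val + 1 = 2 then (1 : L) else 0) w.1) =
        (ϖ : w.1.adicCompletion L) ^ (-((1 : ℕ) : ℤ)) • diagonal h := by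
    rw [formCongr_smul_form, hform, Nat.cast_one, _root_.zpow_neg_one]
  exact (finite_and_ncard_modularStable_of_diagonal_frame (galAdicCompletionMap (L := L) (IsCMField.complexConj L) hw) hϖ' σO hσO' hσσ hres h2O hσϖ
    (hval 0) (hval 1) hfix r hr hsq (placeForm (Matrix.of fun i j : Fin 2 => if i.val + j.val + 1 = 2 then (1 : L) else 0) w.1) γ Q hQγ
    (huv 0) (huv 1) hN hq hform1 i).2.1

set_option maxHeartbeats 400000 in
include hw in
/-- **EXACT-DEPTH COUNT OF THE `γ`-FIXED `ϖ`-MODULAR VERTICES AT A TAMELY RAMIFIED `w`**: `= [i ≤ N ∧ N − i odd]·2q_v^{(N−i−1)∕2}` — B-p12 (g29) cert READING (3) `#B_i(N)`.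
[cite: LabesseLanglands1979, §2 p. 8] [cite: Kottwitz1988, §2] -/
theorem ncard_modularStable_antidiagTwo_depth_eq_ite_at_ramified (he : v.asIdeal.ramificationIdx' w.1.asIdeal ≠ 1) (h2 : Valued.v (2 : w.1.adicCompletion L) = 1)
    (ϖ : (w.1.adicCompletion L)ˣ) (hϖ : Valued.v (ϖ : w.1.adicCompletion L) = WithZero.exp (-1 : ℤ))
    (hσϖ : galAdicCompletionMap (L := L) (IsCMField.complexConj L) hw ϖ = -ϖ)
    {γ P : GL (Fin 2) (w.1.adicCompletion L)} {u : Fin 2 → w.1.adicCompletion L}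
    (hγ : γ ∈ Literature.AlgebraicGeometry.ShimuraVarieties.unitaryGroup (galAdicCompletionMap (L := L) (IsCMField.complexConj L) hw)
      (placeForm (Matrix.of fun i j : Fin 2 => if i.val + j.val + 1 = 2 then (1 : L) else 0) w.1))
    (hP : (γ : Matrix (Fin 2) (Fin 2) (w.1.adicCompletion L)) * P = P * diagonal u) (hu : Function.Injective u)
    (hu1 : ∀ i, galAdicCompletionMap (L := L) (IsCMField.complexConj L) hw (u i) * u i = 1) {N : ℕ}
    (hN : valuation (w.1.adicCompletion L) (u 0 - u 1) = valuation (w.1.adicCompletion L) ((ϖ : w.1.adicCompletion L) ^ N)) (i : ℕ) :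
    {Λ : Submodule 𝒪[w.1.adicCompletion L] (Fin 2 → w.1.adicCompletion L) |
        ((∃ g : GL (Fin 2) (w.1.adicCompletion L),
          (∃ J' ∈ glInt 2 (w.1.adicCompletion L), (ϖ : w.1.adicCompletion L) • (J' : Matrix (Fin 2) (Fin 2) (w.1.adicCompletion L)) =
            formCongr (galAdicCompletionMap (L := L) (IsCMField.complexConj L) hw) g
              (placeForm (Matrix.of fun i j : Fin 2 => if i.val + j.val + 1 = 2 then (1 : L) else 0) w.1)) ∧
          Λ = Submodule.span 𝒪[w.1.adicCompletion L] (Set.range ((g : Matrix (Fin 2) (Fin 2) (w.1.adicCompletion L)))ᵀ)) ∧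
        Λ.map ((Matrix.toLin' ((γ : GL (Fin 2) (w.1.adicCompletion L)) : Matrix (Fin 2) (Fin 2) (w.1.adicCompletion L))).restrictScalars
          𝒪[w.1.adicCompletion L]) = Λ) ∧
        (Λ.map ((Matrix.toLin' (((γ : GL (Fin 2) (w.1.adicCompletion L)) : Matrix (Fin 2) (Fin 2) (w.1.adicCompletion L)) -
            u 1 • (1 : Matrix (Fin 2) (Fin 2) (w.1.adicCompletion L)))).restrictScalars 𝒪[w.1.adicCompletion L]) ≤
          Λ.map ((Matrix.toLin' ((ϖ : w.1.adicCompletion L) ^ i • (1 : Matrix (Fin 2) (Fin 2) (w.1.adicCompletion L)))).restrictScalars 𝒪[w.1.adicCompletion L]) ∧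
        ¬ Λ.map ((Matrix.toLin' (((γ : GL (Fin 2) (w.1.adicCompletion L)) : Matrix (Fin 2) (Fin 2) (w.1.adicCompletion L)) -
            u 1 • (1 : Matrix (Fin 2) (Fin 2) (w.1.adicCompletion L)))).restrictScalars 𝒪[w.1.adicCompletion L]) ≤
          Λ.map ((Matrix.toLin' ((ϖ : w.1.adicCompletion L) ^ (i + 1) • (1 : Matrix (Fin 2) (Fin 2) (w.1.adicCompletion L)))).restrictScalars 𝒪[w.1.adicCompletion L]))}.ncard =
      (if i ≤ N ∧ (N - i) % 2 = 1 then (if N - i = 0 then 1 else 2 * Nat.card (𝓞 ↥(maximalRealSubfield L) ⧸ v.asIdeal) ^ ((N - i) / 2)) else 0) := by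
  obtain ⟨σO, hσO', hσσ, hres, hq⟩ := exists_integer_involution_complexConj_of_ramified L v w hw he
  obtain ⟨Q, h, r, hval, hfix, hform, hQγ, hr, hsq⟩ := exists_diagonal_unit_frame_antidiagTwo_of_ramified L v w hw he h2 σO hσO' hres hγ hP hu hu1
  have hϖ' : IsUniformizingElement (ϖ : w.1.adicCompletion L) := isUniformizingElement_of_v_eq hϖ
  haveI : IsDiscreteValuationRing 𝒪[w.1.adicCompletion L] := isDiscreteValuationRing_integer_of_compatible hϖ
  have h2O : IsUnit (2 : 𝒪[w.1.adicCompletion L]) := by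
    rw [(Valuation.integer.integers (valuation (w.1.adicCompletion L))).isUnit_iff_valuation_eq_one, map_ofNat]
    exact (v_eq_one_iff_valuation_eq_one (2 : w.1.adicCompletion L)).1 h2
  have huv : ∀ i, valuation (w.1.adicCompletion L) (u i) = 1 := fun i => valuation_eq_one_of_galAdicCompletionMap_mul_self L v w hw (hu1 i)
  have hform1 : formCongr (galAdicCompletionMap (L := L) (IsCMField.complexConj L) hw) Q
      ((ϖ : w.1.adicCompletion L)⁻¹ • placeForm (Matrix.of fun i j : Fin 2 => if i.val + j.val + 1 = 2 then (1 : L) else 0) w.1) =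
        (ϖ : w.1.adicCompletion L) ^ (-((1 : ℕ) : ℤ)) • diagonal h := by
    rw [formCongr_smul_form, hform, Nat.cast_one, _root_.zpow_neg_one]
  exact (finite_and_ncard_modularStable_of_diagonal_frame (galAdicCompletionMap (L := L) (IsCMField.complexConj L) hw) hϖ' σO hσO' hσσ hres h2O hσϖ
    (hval 0) (hval 1) hfix r hr hsq (placeForm (Matrix.of fun i j : Fin 2 => if i.val + j.val + 1 = 2 then (1 : L) else 0) w.1) γ Q hQγ
    (huv 0) (huv 1) hN hq hform1 i).2.2

end Modular

/-! ## §4 (ED. 2) The eigenframe orientation of the diagonal unit frame — A-p13 (g32)'s (R5b-α) FILE α2 binders `hP hPh hh0 hh1 hσh r hr hsq` at `(Φ₂)_w` -/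

section Eigenframe

omit [IsCMField L] in
/-- `!![u₀, 0; 0, u₁] = diagonal u` (matrix bookkeeping). [cite: Rogawski1990, §4.9 Lemma 4.9.3 p. 56] -/
private theorem fin_two_eq_diagonal_at (u : Fin 2 → w.1.adicCompletion L) :
    (!![u 0, 0; 0, u 1] : Matrix (Fin 2) (Fin 2) (w.1.adicCompletion L)) = diagonal u := by
  ext i j
  fin_cases i <;> fin_cases j <;> simp [Matrix.diagonal]

include hw in
/-- **THE DIAGONAL UNIT FRAME AS AN EIGENFRAME** (ED. 2, for A-p13 (g32)'s (R5b-α) FILE α2 head): for `γ ∈ U(σ_w, (Φ₂)_w)` with an eigenframe `γ P = P · diag(u)` (`u₀ ≠ u₁` of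
norm one) at a tamely ramified `w`, there is an EIGENFRAME `Q` (`γ Q = Q · diag(u)`) whose Gram matrix `ᵗσ_w(Q)(Φ₂)_w Q = diag h` has UNIT, `σ_w`-fixed entries, together with
`r ∈ 𝒪_w`, `h₀ r = −h₁`, `r̄` a square — §1 with `Q⁻¹γQ = diag(u)` multiplied back by `Q`. [cite: Rogawski1990, §4.9 Lemma 4.9.3 p. 56] [cite: Jacobowitz1962, §8] -/
theorem exists_diagonal_unit_eigenframe_antidiagTwo_of_ramified (he : v.asIdeal.ramificationIdx' w.1.asIdeal ≠ 1) (h2 : Valued.v (2 : w.1.adicCompletion L) = 1)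
    (σO : 𝒪[w.1.adicCompletion L] →+* 𝒪[w.1.adicCompletion L])
    (hσO' : ∀ x : 𝒪[w.1.adicCompletion L], ((σO x : 𝒪[w.1.adicCompletion L]) : w.1.adicCompletion L) = galAdicCompletionMap (L := L) (IsCMField.complexConj L) hw x)
    (hres : ∀ x, σO x - x ∈ maximalIdeal 𝒪[w.1.adicCompletion L])
    {γ P : GL (Fin 2) (w.1.adicCompletion L)} {u : Fin 2 → w.1.adicCompletion L}
    (hγ : γ ∈ Literature.AlgebraicGeometry.ShimuraVarieties.unitaryGroup (galAdicCompletionMap (L := L) (IsCMField.complexConj L) hw)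
      (placeForm (Matrix.of fun i j : Fin 2 => if i.val + j.val + 1 = 2 then (1 : L) else 0) w.1))
    (hP : (γ : Matrix (Fin 2) (Fin 2) (w.1.adicCompletion L)) * P = P * diagonal u) (hu : Function.Injective u)
    (hu1 : ∀ i, galAdicCompletionMap (L := L) (IsCMField.complexConj L) hw (u i) * u i = 1) :
    ∃ (Q : GL (Fin 2) (w.1.adicCompletion L)) (h : Fin 2 → w.1.adicCompletion L) (r : 𝒪[w.1.adicCompletion L]),
      (γ : Matrix (Fin 2) (Fin 2) (w.1.adicCompletion L)) * Q = Q * diagonal u ∧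
      (∀ i, valuation (w.1.adicCompletion L) (h i) = 1) ∧ (∀ i, galAdicCompletionMap (L := L) (IsCMField.complexConj L) hw (h i) = h i) ∧
      formCongr (galAdicCompletionMap (L := L) (IsCMField.complexConj L) hw) Q
        (placeForm (Matrix.of fun i j : Fin 2 => if i.val + j.val + 1 = 2 then (1 : L) else 0) w.1) = diagonal h ∧
      h 0 * (r : w.1.adicCompletion L) = -h 1 ∧ IsSquare (residue 𝒪[w.1.adicCompletion L] r) := by
  obtain ⟨Q, h, r, hval, hfix, hform, hQγ, hr, hsq⟩ := exists_diagonal_unit_frame_antidiagTwo_of_ramified L v w hw he h2 σO hσO' hres hγ hP hu hu1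
  refine ⟨Q, h, r, ?_, hval, hfix, hform, hr, hsq⟩
  have e : (Q : Matrix (Fin 2) (Fin 2) (w.1.adicCompletion L)) * ((Q⁻¹ * γ * Q : GL (Fin 2) (w.1.adicCompletion L)) : Matrix (Fin 2) (Fin 2) (w.1.adicCompletion L)) =
      (γ : Matrix (Fin 2) (Fin 2) (w.1.adicCompletion L)) * Q := by
    rw [← Units.val_mul, ← mul_assoc, ← mul_assoc, mul_inv_cancel, one_mul, Units.val_mul]
  rw [← e, hQγ, fin_two_eq_diagonal_at]

end Eigenframe

end Literature.NumberTheory.Automorphic.UnitaryGroup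

end
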